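import Literature.MathematicalPhysics.QuantumLattice.HubbardCorrelatorCertificate
import Literature.MathematicalPhysics.QuantumLattice.InfVolFermionStateTorusLimitLocalStability
import Literature.MathematicalPhysics.QuantumManyBody.StateRelaxationKKT
import HarnessLib

/-!
# Rung R3/R4 — window certificate rows WITH a state-optimality (KKT) block: tracial sector ground
# states of the Hubbard tori (any filling), the half-filled ground state, and torus-limit ground
# states of `ℤ²` (thermodynamic limit)

HONEST FRAMING (page 1): ladder R1–R4 with certified numbers; no claim on H/H₀.

FILE SPLIT (tree lint: files under `Summits/` are ≤ 400 lines): THIS file = §1, §2, §2′ (generic tracial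
positivity, the torus pull-back of the KKT element, the `D₄` window row with a KKT summand at any
filling); the sequel `KKTWindowRowsTLLimit.lean` = §3 (half filling: ground-state vectors and their
translation averages) and §4 (torus-limit ground states of `ℤ²`). The overview below covers both files.

Block kind `kkt` (pseudo seat, family F4) for the WINDOW certificate format of
`Literature.….HubbardCorrelatorCertificate` (`re_projState_ge_of_window_certificate_d4_ineq`: one
identity in the CAR algebra `𝔄_{Λ'}` of a finite window, objective `X ∈ 𝔄_{Λ'}`, energy constraint
`κ (u·1 − E_Φ)`, affine `D₄` reductions, pulled back into every large torus). The identity may now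
carry, as a further summand, the state-optimality element
`kktForm H_{Λ'} G B̃ = Σ_ab G_ab • (B̃_aᴴ (H_{Λ'} B̃_b − B̃_b H_{Λ'}))`
(`Literature.….StateRelaxation.kktForm`) with the WINDOW Hamiltonian `H_{Λ'}`, a multiplier
`G ⪰ 0`, and generators `B̃_b = Γ(incl) B_b`, `B_b ∈ 𝔄_Λ` supported in the INNER region `Λ` (all
lattice neighbours of `Λ` in `Λ'`) and conserving the local particle number and `S^z`
(`Commute (B_b) N̂_Λ`, `Commute (B_b) S^z_Λ`). Soundness ("the term is a nonnegative residual"):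

* §1 (finite-dimensional, generic): for a Hermitian idempotent `P`, `Re ω_P(X) ≥ 0` as soon as
  `Re ⟨ψ, X ψ⟩ ≥ 0` on the range of `P` (`re_projState_nonneg_of_forall_range`); hence the TRACIAL
  sector ground state `ω_P`, `P` = ground projection of a Hermitian `A` in a sector `K`, obeys the
  ground-state inequality `Re ω_P(Cᴴ (A C − C A)) ≥ 0` for every `C` mapping `K` into `K`
  (`re_projState_conjTranspose_mul_commutator_nonneg_of_sector`; Bratteli–Robinson II
  Prop. 5.3.19 sector-wise, via `re_expect_conjTranspose_mul_commutator_nonneg_of_sectorGS`) and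
  `Re ω_P(kktForm A G B) ≥ 0` for `G ⪰ 0` and sector-preserving generators
  (`re_projState_kktForm_nonneg_of_sector`, weak duality `re_map_kktForm_nonneg`).
* §2 (tori): pulled back into the torus `(ℤ/Lℤ)^d` (`x ↦ x mod L` injective on `thicken Λ' 1`),
  `Γ(kktForm H_{Λ'} G B̃)` has nonnegative real expectation in the tracial ground state of EVERY
  joint sector `(N, S^z = M)` of `hubbardTorus d L t U` (`re_projState_fermionEmbed_kktForm_nonneg`:
  `Γ(H_{Λ'} B̃ − B̃ H_{Λ'}) = H_L ΓB̃ − ΓB̃ H_L` by `hubbardTorus_commutator_fermionEmbed`, and `ΓB̃`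
  preserves the sector). Consequently the window row survives with the KKT summand, at ANY
  filling: `re_projState_ge_of_window_certificate_d4_kkt_ineq` (d = 2, the `D₄` format).
* §3 (half filling, even tori, `t ≠ 0`, `U > 0`): the same bound for every normalised
  `L²`-particle ground-state VECTOR (Lieb's uniqueness,
  `LiebHalfFilled.hubbardTorus_groundState_expect_eq_projState`):
  `groundState_re_expect_ge_of_window_certificate_d4_kkt_ineq`, and its translation average
  `groundState_re_torusAvgExpectAt_ge_of_window_certificate_d4_kkt_ineq`.
* §4 (thermodynamic limit): for every torus-limit ground state `ω` of `ℤ²`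
  (`InfVolFermionState.IsTorusLimitOf`, half filling) with `energyDensity2D t U 1 ≤ u` and `κ ≥ 0`:
  `c − Σₖ ‖aₖ‖ + (Σ_σ μ_σ)(1/2 − ν) ≤ Re ω(X)`
  (`isTorusLimitOf_re_expect_ge_of_window_certificate_d4_kkt_ineq`) — i.e. the `kkt` block is
  ADMISSIBLE on the cell's thermodynamic-limit observable rows (docc / correlator windows).

Validity, exactly as proved: generators must conserve `N̂` and `S^z` (charged generators — `c†`,
pair creators — are NOT covered: the inequality would involve another sector's energy); `G ⪰ 0`;
the KKT element is formed with the window Hamiltonian `H_{Λ'}` of `hubbardFermionInteraction d t U`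
(nearest-neighbour hopping `t`, on-site `U`; no `t'`) and generators supported in the inner region.
No certificate is contained in this file; these are soundness rows for certificates produced and
checked elsewhere (both cell generators must emit the block identically before any certificate
uses it). With the energy itself as objective the block is value-neutral (Araújo et al. Prop. 11);
with an observable objective it is a genuine constraint (Scheer–Chadha–Lu–Khalaf 2025 eq. (2);
Fawzi–Fawzi–Scalet 2024 §2).

## References
* O. Bratteli, D. W. Robinson, *Operator Algebras and Quantum Statistical Mechanics 2*, 2nd ed.
  (1997), Prop. 5.3.19, Prop. 5.3.25, §6.2.4. [cite: BratteliRobinsonII1997, Prop. 5.3.19]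
* J. Wang et al., *Certifying ground-state properties of many-body systems*, PRX 14 (2024) 031006,
  §III. [cite: WangEtAl2024, §III]
* M. Araújo, I. Klep, A. J. P. Garner, T. Vértesi, M. Navascués, arXiv:2311.18707, §3.2 Prop. 11.
  [cite: AraujoEtAl2023, §3.2 Prop. 11]
* M. G. Scheer, N. Chadha, D.-C. Lu, E. Khalaf, arXiv:2511.20860, §II eq. (2).
  [cite: ScheerEtAl2025, §II eq. (2)]
* H. Fawzi, O. Fawzi, S. O. Scalet, Nat. Commun. 15 (2024) 7394, §2. [cite: FawziFawziScalet2024, §2]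
* E. H. Lieb, PRL 62 (1989) 1201, Theorem 2. [cite: LiebPRL1989, Theorem 2]
-/

noncomputable section

namespace Summit.HubbardSuperconductivity.HubbardLadder

open Literature.MathematicalPhysics.QuantumLattice Literature.Probability.LatticeModels
  Literature.MathematicalPhysics.QuantumManyBody.StateRelaxation
open Matrix Finset Filter
open scoped ComplexOrder BigOperators

/-! ## §1 Tracial states of projections: positivity transferred from the range -/

section MatrixInstances

variable {n : Type*} [Fintype n] [DecidableEq n]
variable {m : Type*} [Fintype m] [DecidableEq m]

/-- **`Re ω_P(X) ≥ 0` from the range of `P`.** For a Hermitian idempotent `P` and any `X` with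
`Re ⟨ψ, X ψ⟩ ≥ 0` for every `ψ = P v` in the range of `P`: `0 ≤ Re ω_P(X)`
(`ω_P(X) = tr(P X)/tr P = tr(P X P)/tr P = Σᵢ ⟨P eᵢ, X P eᵢ⟩ / tr P`). [folklore] -/
theorem re_projState_nonneg_of_forall_range {P X : Matrix n n ℂ} (hP : P.IsHermitian)
    (hP2 : P * P = P) (h : ∀ v : n → ℂ, 0 ≤ (star (P *ᵥ v) ⬝ᵥ X *ᵥ (P *ᵥ v)).re) :
    0 ≤ (P.projState X).re := by
  -- `tr (P X) = tr (P X P) = Σᵢ ⟨P eᵢ, X P eᵢ⟩`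
  have htr : (P * (X * P)).trace = (P * X).trace := by
    rw [← mul_assoc, Matrix.trace_mul_comm, ← mul_assoc, hP2]
  have hentry : ∀ i : n,
      (P * (X * P)) i i = star (P *ᵥ Pi.single i 1) ⬝ᵥ X *ᵥ (P *ᵥ Pi.single i 1) := by
    intro i
    have hcol : P *ᵥ Pi.single i 1 = fun j => P j i := by rw [Matrix.mulVec_single_one]; rfl
    have hstar : star (fun j => P j i) = fun j => P i j := by
      funext j
      show star (P j i) = P i j
      exact hP.apply i j
    rw [hcol, hstar]
    simp only [Matrix.mul_apply, dotProduct, Matrix.mulVec]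
  have hsum : 0 ≤ ((P * (X * P)).trace).re := by
    rw [Matrix.trace, Complex.re_sum]
    exact Finset.sum_nonneg fun i _ => by rw [Matrix.diag_apply, hentry i]; exact h _
  -- the normalisation `(tr P)⁻¹` is a nonnegative real
  obtain ⟨hpsd, hPP⟩ := posSemidef_of_proj hP hP2
  rw [hPP] at hpsd
  obtain ⟨hre, him⟩ := Complex.nonneg_iff.mp hpsd.trace_nonneg
  rw [projState_apply, ← htr, Complex.mul_re, Complex.inv_re, Complex.inv_im, ← him, neg_zero,
    zero_div, zero_mul, sub_zero]
  exact mul_nonneg (div_nonneg hre (Complex.normSq_nonneg _)) hsum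

/-- **The ground-state inequality for the TRACIAL sector ground state.** For Hermitian `A`, a
sector `K`, `P` the ground projection of `A` in `K` (`Matrix.sectorGroundProj`) and `C` mapping `K`
into `K`: `0 ≤ Re ω_P(Cᴴ (A C − C A))` (each `ψ = P v` lies in `K` with `A ψ = E_K ψ`, so
`⟨ψ, Cᴴ (A C − C A) ψ⟩ = ⟨Cψ, (A − E_K) Cψ⟩ ≥ 0`). Junk-safe: for `P = 0` both sides vanish.
[cite: BratteliRobinsonII1997, Prop. 5.3.19] -/
theorem re_projState_conjTranspose_mul_commutator_nonneg_of_sector {A C : Matrix n n ℂ}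
    (hA : A.IsHermitian) (K : Submodule ℂ (n → ℂ)) (hC : ∀ w ∈ K, C *ᵥ w ∈ K) :
    0 ≤ ((A.sectorGroundProj K).projState (Cᴴ * (A * C - C * A))).re :=
  re_projState_nonneg_of_forall_range (sectorGroundProj_isHermitian A K)
    (sectorGroundProj_mul_self A K) fun v =>
    re_expect_conjTranspose_mul_commutator_nonneg_of_sectorGS hA K hC
      (sectorGroundProj_mulVec_mem_sector A K v)
      ((mem_sectorGroundSpace_iff A K _).1 (sectorGroundProj_mulVec_mem A K v)).2

/-- **KKT block ⇒ nonnegative in the tracial sector ground state.** For Hermitian `A`, a sector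
`K`, a multiplier `G ⪰ 0` and generators `B_b` mapping `K` into `K`:
`0 ≤ Re ω_P(kktForm A G B)`, `P` the ground projection of `A` in `K` (factor `G = Lᴴ L` and apply
the ground-state inequality to each `C_k = Σ_b L_kb B_b`, `re_map_kktForm_nonneg`).
[cite: AraujoEtAl2023, §3.2 Prop. 11] [cite: BratteliRobinsonII1997, Prop. 5.3.19] -/
theorem re_projState_kktForm_nonneg_of_sector {A : Matrix n n ℂ} (hA : A.IsHermitian)
    (K : Submodule ℂ (n → ℂ)) {G : Matrix m m ℂ} (hG : G.PosSemidef) (B : m → Matrix n n ℂ)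
    (hB : ∀ j, ∀ w ∈ K, B j *ᵥ w ∈ K) :
    0 ≤ ((A.sectorGroundProj K).projState (kktForm A G B)).re :=
  re_map_kktForm_nonneg _ A hG B fun c => by
    rw [Matrix.star_eq_conjTranspose]
    exact re_projState_conjTranspose_mul_commutator_nonneg_of_sector hA K fun w hw => by
      rw [Matrix.sum_mulVec]
      exact K.sum_mem fun j _ => by rw [Matrix.smul_mulVec]; exact K.smul_mem _ (hB j w hw)

end MatrixInstances

/-! ## §2 The Hubbard tori: the pulled-back window KKT element, tracial sector ground states -/

section Torus

variable {d : ℕ} (L : ℕ) [NeZero L]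

/-- (Local to this section, as in `HubbardCorrelatorCertificate`.) [folklore] -/
local instance (priority := high) instDecidableEqFermionTorusKKT : DecidableEq (FermionTorus d L) :=
  LinearOrder.toDecidableEq

/-- **The window KKT element is nonnegative in every tracial sector ground state of the torus.**
Regions `Λ ⊆ Λ' ⊆ ℤ^d` with all lattice neighbours of `Λ` in `Λ'`, `x ↦ x mod L` injective on
`thicken Λ' 1`; generators `B_b ∈ 𝔄_Λ` conserving the local `N̂` and `S^z`; `G ⪰ 0`. Then in the
tracial ground state `ω_P` of ANY joint sector `(N, S^z = M)` of `hubbardTorus d L t U`: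
`0 ≤ Re ω_P(Γ(ι_{Λ',L}) kktForm H_{Λ'} G (Γ(incl) ∘ B))` — because
`Γ(H_{Λ'} B̃ − B̃ H_{Λ'}) = H_L ΓB̃ − ΓB̃ H_L` (`hubbardTorus_commutator_fermionEmbed`) and `ΓB̃`
preserves the sector (`commute_fermionEmbed_toTorusEmb_totalNumber`, `…_spinZ`).
[cite: BratteliRobinsonII1997, Prop. 5.3.19] [cite: ScheerEtAl2025, §II eq. (2)] -/
theorem re_projState_fermionEmbed_kktForm_nonneg (t U : ℝ) {Λ Λ' : Finset (Site d)} (hΛ : Λ ⊆ Λ')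
    (hclosed : ∀ x ∈ Λ, ∀ i : Fin d, x + unitVec i ∈ Λ' ∧ x - unitVec i ∈ Λ')
    (hInj : Set.InjOn (Torus.proj (d := d) L) ↑(thicken Λ' 1))
    (hInj' : Set.InjOn (Torus.proj (d := d) L) ↑Λ') (N : ℕ) (M : ℝ)
    {β : Type*} [Fintype β] [DecidableEq β] {G : Matrix β β ℂ} (hG : G.PosSemidef)
    (Bk : β → FermionOp Λ) (hBN : ∀ b, Commute (Bk b) totalNumber)
    (hBS : ∀ b, Commute (Bk b) HubbardWave0.spinZ) :
    0 ≤ (((hubbardTorus d L t U).sectorGroundProj (szSector N M)).projState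
        (fermionEmbed (PolySite.toTorusEmb L hInj')
          (kktForm ((hubbardFermionInteraction d t U).localHamiltonian Λ') G
            (fun b => fermionEmbed (PolySite.incl hΛ) (Bk b))))).re := by
  have hInjΛ : Set.InjOn (Torus.proj (d := d) L) ↑Λ := hInj'.mono (by exact_mod_cast hΛ)
  have hH : (hubbardTorus d L t U).IsHermitian :=
    hubbardTorus_isHermitian (hamiltonian_isHermitian_and_commute_holds _) t U
  set ω' : FermionOp Λ' →ₗ[ℂ] ℂ :=
    ((hubbardTorus d L t U).sectorGroundProj (szSector N M)).projState ∘ₗ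
      (fermionEmbed (PolySite.toTorusEmb L hInj')).toLinearMap with hω'
  have hω'app : ∀ x, ω' x = ((hubbardTorus d L t U).sectorGroundProj (szSector N M)).projState
      (fermionEmbed (PolySite.toTorusEmb L hInj') x) := fun _ => rfl
  have h := re_map_kktForm_nonneg ω' ((hubbardFermionInteraction d t U).localHamiltonian Λ') hG
    (fun b => fermionEmbed (PolySite.incl hΛ) (Bk b)) fun wc => ?_
  · rwa [hω'app] at h
  -- the ground-state inequality for the generator `C = Γ(Σ_b wc_b B_b)`
  have hsum : ∑ j, wc j • fermionEmbed (PolySite.incl hΛ) (Bk j) =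
      fermionEmbed (PolySite.incl hΛ) (∑ j, wc j • Bk j) := by
    rw [fermionEmbed_sum]
    exact Finset.sum_congr rfl fun j _ => (fermionEmbed_smul _ _ _).symm
  have hAwN : Commute (∑ j, wc j • Bk j) totalNumber :=
    Commute.sum_left _ _ _ fun j _ => Commute.smul_left (hBN j) _
  have hAwS : Commute (∑ j, wc j • Bk j) HubbardWave0.spinZ :=
    Commute.sum_left _ _ _ fun j _ => Commute.smul_left (hBS j) _
  have hB : fermionEmbed (PolySite.toTorusEmb L hInj') (fermionEmbed (PolySite.incl hΛ) (∑ j, wc j • Bk j)) =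
      fermionEmbed (PolySite.toTorusEmb L hInjΛ) (∑ j, wc j • Bk j) := by
    rw [fermionEmbed_fermionEmbed]
    exact congrFun (congrArg DFunLike.coe (fermionEmbed_congr fun p => rfl)) _
  rw [hsum, hω'app, Matrix.star_eq_conjTranspose, fermionEmbed_mul, fermionEmbed_conjTranspose,
    ← hubbardTorus_commutator_fermionEmbed L t U hΛ hclosed hInj (∑ j, wc j • Bk j), hB]
  exact re_projState_conjTranspose_mul_commutator_nonneg_of_sector hH (szSector N M) fun v hv =>
    mulVec_mem_szSector_of_commute (commute_fermionEmbed_toTorusEmb_totalNumber L hInjΛ hAwN)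
      (commute_fermionEmbed_toTorusEmb_spinZ L hInjΛ hAwS) hv

end Torus

/-! ## §2′ The `D₄` window row with a KKT summand, any filling -/

section Window

variable {L : ℕ} [NeZero L]

/-- (Local to this section, as in `HubbardCorrelatorCertificate`.) [folklore] -/
local instance (priority := high) instDecidableEqFermionTorusKKT' : DecidableEq (FermionTorus 2 L) :=
  LinearOrder.toDecidableEq

/-- Moving a summand of the right-hand side of a certificate identity into the objective:
`X − c − S − K = R + k ⇒ (X − k) − c − S − K = R`. [folklore] -/
private theorem cert_sub_kkt {A : Type*} [AddCommGroup A] {X c S K R k : A}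
    (h : X - c - S - K = R + k) : X - k - c - S - K = R := by
  rw [eq_sub_of_add_eq h.symm]
  abel

/-- **Window certificate with energy constraint, affine `D₄` reductions AND a KKT block ⇒
ground-state expectation of a local observable on every large square torus, any filling.** Data
as in `re_projState_ge_of_window_certificate_d4_ineq` (HubbardCorrelatorCertificate) plus a
multiplier `G ⪰ 0` and generators `B_b ∈ 𝔄_Λ` (inner region) with `[B_b, N̂_Λ] = [B_b, S^z_Λ] = 0`;
the identity in `𝔄_{Λ'}` reads
`X − c·1 − Σ_σ μ_σ (n_{0σ} − ν·1) − κ (u·1 − Γ(incl) E_Φ) = Σ Λₐᵦ Oₐᴴ O_b + (null terms)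
   + (Σₘ dₘ (Vₘᴴ − Vₘ) + Σₖ aₖ wordsₖ) + kktForm H_{Λ'} G (Γ(incl) ∘ B)`.
Then for every `L ≥ 3` with `x ↦ x mod L` injective on `thicken Λ' 1` and every `n ≤ L²`, in the
tracial ground state `ω_P` of the sector `(2n, S^z = 0)` of `(ℤ/Lℤ)²`:
`c − Σₖ ‖aₖ‖ + (Σ_σ μ_σ)(n/L² − ν) + κ (u − E₀(2n)/L²) ≤ Re ω_P(Γ(ι_{Λ',L}) X)`.
(The row without the block applied to the objective `X − kktForm …`, plus
`re_projState_fermionEmbed_kktForm_nonneg`.) [cite: WangEtAl2024, §III]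
[cite: ScheerEtAl2025, §II eq. (2)] -/
theorem re_projState_ge_of_window_certificate_d4_kkt_ineq (t U : ℝ) (hL : 3 ≤ L) {nh : ℕ}
    (hn : nh ≤ Fintype.card (FermionTorus 2 L))
    {Λ Λ' : Finset (Site 2)} (hΛ : Λ ⊆ Λ')
    (hclosed : ∀ x ∈ Λ, ∀ i : Fin 2, x + unitVec i ∈ Λ' ∧ x - unitVec i ∈ Λ')
    (h0 : thicken ({0} : Finset (Site 2)) 1 ⊆ Λ') (hz : (0 : Site 2) ∈ Λ')
    (hInj : Set.InjOn (Torus.proj (d := 2) L) ↑(thicken Λ' 1))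
    (hInj' : Set.InjOn (Torus.proj (d := 2) L) ↑Λ')
    (Xw : FermionOp Λ') (κ u : ℝ) (μ : Fin 2 → ℝ) (ν : ℝ)
    {m : Type*} [Fintype m] [DecidableEq m] {Λm : Matrix m m ℂ} (hΛm : Λm.PosSemidef)
    (O : m → FermionOp Λ')
    {κ' : Type*} (s : Finset κ') (B : κ' → FermionOp Λ)
    {ι : Type*} (tt : Finset ι) (γ : ι → DihedralGroup 4) (wv : ι → Site 2)
    (hsh : ∀ l, d4ShiftSet (γ l) (wv l) Λ ⊆ Λ') (Y : ι → FermionOp Λ)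
    {ρ : Type*} (uu : Finset ρ) (b : ρ → ℂ) (cw : ρ → List (Orb (PolySite Λ') × Bool))
    (hcw : ∀ j ∈ uu, ladderCharge (cw j) ≠ 0 ∨ ladderSpinCharge (cw j) ≠ 0)
    {δ : Type*} (ah : Finset δ) (dc : δ → ℝ) (V : δ → FermionOp Λ')
    {κ'' : Type*} (w : Finset κ'') (a : κ'' → ℂ) (word : κ'' → List (Orb (PolySite Λ') × Bool))
    {β : Type*} [Fintype β] [DecidableEq β] {G : Matrix β β ℂ} (hG : G.PosSemidef)
    (Bk : β → FermionOp Λ) (hBN : ∀ b', Commute (Bk b') totalNumber)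
    (hBS : ∀ b', Commute (Bk b') HubbardWave0.spinZ) {c : ℝ}
    (hcert : Xw - (c : ℂ) • (1 : FermionOp Λ') -
        ∑ σ : Fin 2, ((μ σ : ℝ) : ℂ) • (nAt 0 hz σ - ((ν : ℝ) : ℂ) • (1 : FermionOp Λ')) -
        ((κ : ℝ) : ℂ) • (((u : ℝ) : ℂ) • (1 : FermionOp Λ') -
          fermionEmbed (PolySite.incl h0) ((hubbardFermionInteraction 2 t U).meanEnergyObs 1)) =
      gramForm Λm O +
        (∑ k ∈ s, ((hubbardFermionInteraction 2 t U).localHamiltonian Λ' * fermionEmbed (PolySite.incl hΛ) (B k) -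
            fermionEmbed (PolySite.incl hΛ) (B k) * (hubbardFermionInteraction 2 t U).localHamiltonian Λ') +
          ∑ l ∈ tt, (fermionEmbed (PolySite.incl (hsh l)) (fermionEmbed (PolySite.d4Emb (γ l) (wv l) Λ) (Y l)) -
            fermionEmbed (PolySite.incl hΛ) (Y l)) +
          ∑ j ∈ uu, b j • ladderWord (cw j)) +
        (∑ m' ∈ ah, ((dc m' : ℝ) : ℂ) • ((V m')ᴴ - V m') + ∑ k ∈ w, a k • ladderWord (word k)) +
        kktForm ((hubbardFermionInteraction 2 t U).localHamiltonian Λ') G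
          (fun b' => fermionEmbed (PolySite.incl hΛ) (Bk b'))) :
    c - ∑ k ∈ w, ‖a k‖ + (∑ σ : Fin 2, μ σ) * ((nh : ℝ) / (L : ℝ) ^ 2 - ν) +
        κ * (u - groundEnergyAt (fermionTorusGraph 2 L) t U (2 * nh) / (L : ℝ) ^ 2) ≤
      (((hubbardTorus 2 L t U).sectorGroundProj (szSector (2 * nh) 0)).projState
        (fermionEmbed (PolySite.toTorusEmb L hInj') Xw)).re := by
  -- the row WITHOUT the block, for the objective `X − kktForm …`
  have hmain := re_projState_ge_of_window_certificate_d4_ineq t U hL hn hΛ hclosed h0 hz hInj hInj'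
    (Xw - kktForm ((hubbardFermionInteraction 2 t U).localHamiltonian Λ') G
      (fun b' => fermionEmbed (PolySite.incl hΛ) (Bk b'))) κ u μ ν hΛm O s B tt γ wv hsh Y uu b cw
    hcw ah dc V w a word (cert_sub_kkt hcert)
  -- the block is a nonnegative residual in the tracial sector ground state
  have hkkt := re_projState_fermionEmbed_kktForm_nonneg L t U hΛ hclosed hInj hInj' (2 * nh) 0 hG Bk hBN hBS
  rw [map_sub, map_sub, Complex.sub_re] at hmain
  linarith

end Window

end Summit.HubbardSuperconductivity.HubbardLadder
end
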